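/-
Copyright (c) 2026. All rights reserved.
Released under Apache 2.0 license as described in the file LICENSE.
-/
import Literature.AlgebraicGeometry.ComplexMultiplication.HyperellipticJacobianTwelveTimesOddLevel
import HarnessLib

/-!
# GGL 2024 Thm. 3.0 + Lemma 14 at the levels `24 ∣ m`, `5 ∤ m`:
# `End⁰(J_m) ≅ Mat₄(ℚ(√−6)) × Mat₃(ℚ(i)) × ∏_{d ∣ m odd, d ≠ 1} Mat₂(ℚ(ζ_d)) × ∏_{4 ∣ e ∣ m, e ∉ {4, 12, 24}} Mat₂(ℚ(ζ_e − ζ_e⁻¹))`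

Layer `Literature/AlgebraicGeometry/ComplexMultiplication`, namespace `…ComplexMultiplication.HyperellipticJacobian`; the family-form assembly of
`HyperellipticJacobianTwelveTimesOddLevel` (F25) with the exceptional block `Y_{24}` (`End⁰(X_{24}) ≅ Mat₄(F_{24})`, `F_{24} = ℚ(√−6)`, F9 ∕ F18) prepended.
THEOREMS ONLY (no definition, no named fact, no `sorry`, no instance).

## The print

A. Gallese, H. Goodson, D. Lombardo, arXiv:2405.20394 [GalleseGoodsonLombardo2024] (held `paper:arxiv-2405.20394`, p0012, p0014, p0015): THM. 3.0
«`J_m ∼ ∏_{d ∣ m, d ≠ 1,2} X_d`», (4), (5), «`X_{24} ∼ Y_{24}⁴`», the last statement; §3.4 (`F_{24} = ℚ(√−6)`); §3.5 LEMMA 14 ((1)–(3)) with the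
sentence following it.  When `24 ∣ m` and `5 ∤ m` the divisors `d ∉ {1, 2}` of `m` are: `24` (block `Mat₄(ℚ(√−6))`); `4, 12` (block `Mat₃(ℚ(i))`);
the pairs `{d, 2d}` over the odd divisors `d ≠ 1`; and the `e` with `4 ∣ e`, `e ∉ {4, 12, 24}` — all non-exceptional (`20, 60 ∤ m`), pairwise
orthogonal `Y`-blocks — so `End⁰(J_m) ≅ Mat₄(ℚ(√−6)) × Mat₃(ℚ(ζ_4)) × ∏_d Mat₂(ℚ(ζ_d)) × ∏_e Mat₂(ℚ(ζ_e − ζ_e⁻¹))`, of dimension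
`50 + 4 Σ_d φ(d) + 2 Σ_e φ(e)`, and `2 dim J_m = 14 + 2 Σ_d φ(d) + Σ_e φ(e)` (`m = 24`: `66`, `g = 11`, F18; `m = 48`: `114`, `g = 23`; `m = 72`:
`162`, `g = 35`).

## The carrier (family form)

`![A₂₄, A₄ ⊕ A₁₂, ⨁_i (A_i ⊕ A′_i), ⨁_j C_j]` over `Fin 4` (= `vecCons A₂₄` of the F25 carrier): `A₂₄` a realisation of the lower-half type of
`ℚ(ζ_{24})`; `A₄`, `A₁₂`, `A_i` (`d_i ∣ M` odd `> 1`, distinct), `A′_i` (`2d_i`), `C_j` (`4 ∣ e_j ≥ 8`, `e_j ∉ {12, 20, 24, 60}`, distinct) as in F25.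

## What is proved

§1 the `Y_{24}` column in family form: `orthogonal_odd_twentyFour'` (every odd `d ≥ 3`), `orthogonal_twiceOdd_twentyFour` (every `2n`, `n` odd `≥ 3`),
**`orthogonal_fourDvd_twentyFour`** (every non-exceptional `4 ∣ e ≥ 8`); §2 **`hom_eq_zero_blocks_twentyFourDvd`**,
**`nonempty_endAlgebra_algEquiv_twentyFourDvd`**, **`finrank_endAlgebra_twentyFourDvd`**.

## Honest column ∕ NOT here

The curve; `20 ∣ m` (blocks `Y_{20}`, `Y_{60}`); the closed forms of the sums.  `HC_CM` is not touched.

## References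

* [GalleseGoodsonLombardo2024] arXiv:2405.20394 — §3 Thm. 3.0, §3.4, §3.5 Lemma 14 and the sentence following it.
* [MumfordAV1970] D. Mumford — §19 Thm. 3 Cor. 1–2, p. 174.
* [Shimura1998] G. Shimura — §5.1 Prop. 3, 4, 6, §8.3 Prop. 28.
* [MilneCM2006] J. S. Milne — Ch. I §1 Prop. 1.18 (c), §3 Prop. 3.13.

## Provenance

Cell `pub-hodgecm2` (COR-CM), KEPT Literature lane `lit-deligne-3` gen 52 (claim GGL24-TWENTYFOUR-DVD; count-neutral, own lane).
-/

noncomputable section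

open CategoryTheory CategoryTheory.Limits NumberField Module

namespace Literature.AlgebraicGeometry.ComplexMultiplication

open Literature.AlgebraicGeometry.Motives
open Literature.AlgebraicGeometry.HodgeTheory (complexBetti)
open Literature.NumberTheory.ComplexMultiplication

namespace HyperellipticJacobian

open Literature.AlgebraicGeometry.Pohlmann1968 Literature.AlgebraicGeometry.Pohlmann1968.Cyclotomic

/-! ## §0 Arithmetic -/

section Arithmetic

/-- An odd number of totient `≤ 2` is `1` or `3`. [folklore] -/
private theorem eq_one_or_three_of_odd_of_totient_le_two' {q : ℕ} (hq : Odd q) (hφ : Nat.totient q ≤ 2) : q = 1 ∨ q = 3 := by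
  by_cases hq1 : q = 1
  · exact Or.inl hq1
  right
  have hpp : q.minFac.Prime := Nat.minFac_prime hq1
  obtain ⟨r, hr⟩ := Nat.minFac_dvd q
  have hr0 : 0 < r := by
    refine Nat.pos_of_ne_zero ?_
    rintro rfl
    rw [mul_zero] at hr
    have := hq.pos
    omega
  have hrodd : Odd r := hq.of_dvd_nat ⟨q.minFac, hr.trans (mul_comm _ _)⟩
  have hpodd : Odd q.minFac := hq.of_dvd_nat ⟨r, hr⟩
  have hp3 : 3 ≤ q.minFac := by
    have h2 := hpp.two_le
    rcases Nat.eq_or_lt_of_le h2 with h | h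
    · rw [← h] at hpodd
      exact absurd hpodd (by decide)
    · omega
  have key : (q.minFac - 1) * Nat.totient r ≤ 2 := by
    calc (q.minFac - 1) * Nat.totient r = Nat.totient q.minFac * Nat.totient r := by rw [Nat.totient_prime hpp]
      _ ≤ Nat.totient (q.minFac * r) := Nat.totient_super_multiplicative _ _
      _ = Nat.totient q := by rw [← hr]
      _ ≤ 2 := hφ
  have hφr : 0 < Nat.totient r := Nat.totient_pos.2 hr0
  have hp3' : q.minFac = 3 := by
    have : (q.minFac - 1) * 1 ≤ 2 := le_trans (Nat.mul_le_mul_left _ hφr) key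
    omega
  have hφr1 : Nat.totient r ≤ 1 := by
    rw [hp3'] at key
    omega
  have hr2 : r ∣ 2 := Nat.dvd_two_of_totient_le_one hr0 hφr1
  have hr1 : r = 1 := by
    rcases (Nat.dvd_prime Nat.prime_two).1 hr2 with h | h
    · exact h
    · rw [h] at hrodd
      exact absurd hrodd (by decide)
  rw [hr, hp3', hr1]

/-- `φ(2n) ≠ 2` for odd `n ≥ 3` not divisible by `3`. [folklore] -/
private theorem totient_two_mul_ne_two_of_odd {n : ℕ} (hn : Odd n) (h3 : 3 ≤ n) (hn3 : ¬ 3 ∣ n) : Nat.totient (2 * n) ≠ 2 := by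
  intro h
  rw [Nat.totient_mul (Nat.coprime_two_left.2 hn), Nat.totient_two, one_mul] at h
  rcases eq_one_or_three_of_odd_of_totient_le_two' hn h.le with h1 | h3'
  · omega
  · exact hn3 (by rw [h3'])

/-- A multiple of `8` dividing `24` other than `8` and `24` does not exist. [folklore] -/
private theorem not_dvd_twentyFour_of_eight_dvd {e : ℕ} (h8 : 8 ∣ e) (he8 : e ≠ 8) (he24 : e ≠ 24) : ¬ e ∣ 24 := by
  intro h
  obtain ⟨t, rfl⟩ := h8
  have ht : t ∣ 3 := (Nat.mul_dvd_mul_iff_left (by norm_num : 0 < 8)).1 (by simpa using h)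
  rcases (Nat.dvd_prime Nat.prime_three).1 ht with rfl | rfl
  · exact he8 rfl
  · exact he24 rfl

end Arithmetic

/-! ## §1 The `Y_{24}` column in family form -/

section TwentyFourColumn

variable {d : ℕ} [NeZero d] {K : Type} [Field K] [NumberField K] [IsCyclotomicExtension {d} ℚ K] {Φ : CMType K}
  {A : AbelianVariety ℂ} {ι : 𝓞 K →+* End A} {θ : K →+* Module.End ℂ (complexBetti A.X 1)}
  {n : ℕ} [NeZero (2 * n)] {L : Type} [Field L] [NumberField L] [IsCyclotomicExtension {2 * n} ℚ L] {Ψ : CMType L}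
  {B : AbelianVariety ℂ} {ιB : 𝓞 L →+* End B} {θB : L →+* Module.End ℂ (complexBetti B.X 1)}
  {K' : Type} [Field K'] [NumberField K'] [IsCyclotomicExtension {24} ℚ K'] {Φ' : CMType K'}
  {A' : AbelianVariety ℂ} {ι' : 𝓞 K' →+* End A'} {θ' : K' →+* Module.End ℂ (complexBetti A'.X 1)}

/-- **`X_d ⟂ Y_{24}` for EVERY odd `d ≥ 3`** (`d ≠ 3`: F12 `orthogonal_odd_twentyFour`; `3 ∣ d`: F17 `orthogonal_odd_twentyFour_of_three_dvd`).
[cite: GalleseGoodsonLombardo2024, §3 Thm. 3.0 (last statement) and §3.4] [cite: MilneCM2006, Ch. I §3 Prop. 3.13] -/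
theorem orthogonal_odd_twentyFour' (hd : Odd d) (h3 : 3 ≤ d) (hΦ : ∀ σ : K →+* ℂ, σ ∈ Φ.1 ↔ 2 * (expOf d K σ).val < d)
    (hA : IsCMTypeRealisation Φ A ι θ) (hΦ' : ∀ σ : K' →+* ℂ, σ ∈ Φ'.1 ↔ 2 * (expOf 24 K' σ).val < 24)
    (hA' : IsCMTypeRealisation Φ' A' ι' θ') :
    (∀ u : A ⟶ A', u = 0) ∧ (∀ v : A' ⟶ A, v = 0) ∧
      ¬ AbelianVariety.IsIsogenous A A' ∧ ¬ AbelianVariety.IsIsogenous A' A := by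
  by_cases h3d : 3 ∣ d
  · exact orthogonal_odd_twentyFour_of_three_dvd hd h3d hΦ hA hΦ' hA'
  · exact orthogonal_odd_twentyFour hd h3 (fun h => h3d (by rw [h])) hΦ hA hA'

/-- **`X_{2n} ⟂ Y_{24}` for EVERY odd `n ≥ 3`** (`3 ∣ n`: F17 `…_of_three_dvd`; `3 ∤ n`: `φ(2n) ≠ 2`, F17 `…_of_totient_ne_two`).
[cite: GalleseGoodsonLombardo2024, §3 Thm. 3.0 (4), (last statement) and §3.4] [cite: MilneCM2006, Ch. I §1 Prop. 1.18 (c), §3 Prop. 3.13] -/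
theorem orthogonal_twiceOdd_twentyFour (hn : Odd n) (h3n : 3 ≤ n)
    (hΨ : ∀ σ : L →+* ℂ, σ ∈ Ψ.1 ↔ 2 * (expOf (2 * n) L σ).val < 2 * n) (hB : IsCMTypeRealisation Ψ B ιB θB)
    (hΦ' : ∀ σ : K' →+* ℂ, σ ∈ Φ'.1 ↔ 2 * (expOf 24 K' σ).val < 24) (hA' : IsCMTypeRealisation Φ' A' ι' θ') :
    (∀ u : B ⟶ A', u = 0) ∧ (∀ v : A' ⟶ B, v = 0) ∧
      ¬ AbelianVariety.IsIsogenous B A' ∧ ¬ AbelianVariety.IsIsogenous A' B := by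
  by_cases h3d : 3 ∣ n
  · exact orthogonal_twiceOdd_twentyFour_of_three_dvd hn h3n h3d hΨ hB hΦ' hA'
  · exact orthogonal_twiceOdd_twentyFour_of_totient_ne_two hn h3n (totient_two_mul_ne_two_of_odd hn h3n h3d) hΨ hB hΦ' hA'

/-- `Y_8 ⟂ Y_{24}` for a level written as a variable `d = 8` (F17 `orthogonal_eight_twentyFour`, transported along `d = 8`). [folklore] -/
private theorem orthogonal_levelEight_twentyFour (hd8 : d = 8) (hΦ : ∀ σ : K →+* ℂ, σ ∈ Φ.1 ↔ 2 * (expOf d K σ).val < d)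
    (hA : IsCMTypeRealisation Φ A ι θ) (hΦ' : ∀ σ : K' →+* ℂ, σ ∈ Φ'.1 ↔ 2 * (expOf 24 K' σ).val < 24)
    (hA' : IsCMTypeRealisation Φ' A' ι' θ') :
    (∀ u : A ⟶ A', u = 0) ∧ (∀ v : A' ⟶ A, v = 0) := by
  subst hd8
  exact ⟨(orthogonal_eight_twentyFour hΦ hA hΦ' hA').1, (orthogonal_eight_twentyFour hΦ hA hΦ' hA').2.1⟩

/-- **`Y_e ⟂ Y_{24}` for EVERY non-exceptional `4 ∣ e ≥ 8`** (`8 ∤ e`: `i ∈ K*(Φ_e) ∌ ℚ(√−6)`, F16; `e = 8`: F17; `8 ∣ e ∉ {8, 24}`: a primitive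
`e`-th root of unity would lie in `x′(ℚ(ζ_{24}))`, F23): `Hom = 0` both ways.
[cite: GalleseGoodsonLombardo2024, §3 Thm. 3.0 (last statement) and §3.4] [cite: MilneCM2006, Ch. I §3 Prop. 3.13] -/
theorem orthogonal_fourDvd_twentyFour (h4 : 4 ∣ d) (h8 : 8 ≤ d) (h20 : d ≠ 20) (h24 : d ≠ 24) (h60 : d ≠ 60)
    (hΦ : ∀ σ : K →+* ℂ, σ ∈ Φ.1 ↔ 2 * (expOf d K σ).val < d) (hA : IsCMTypeRealisation Φ A ι θ)
    (hΦ' : ∀ σ : K' →+* ℂ, σ ∈ Φ'.1 ↔ 2 * (expOf 24 K' σ).val < 24) (hA' : IsCMTypeRealisation Φ' A' ι' θ') :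
    (∀ u : A ⟶ A', u = 0) ∧ (∀ v : A' ⟶ A, v = 0) := by
  haveI : NeZero (24 : ℕ) := ⟨by norm_num⟩
  by_cases h8d : 8 ∣ d
  · by_cases hd8 : d = 8
    · exact orthogonal_levelEight_twentyFour hd8 hΦ hA hΦ' hA'
    · have h := orthogonal_fourDvd_of_eight_dvd_of_not_dvd 24 h8d h24 hΦ hA (by norm_num) (not_dvd_twentyFour_of_eight_dvd h8d hd8 h24) hA'
      exact ⟨h.1, h.2.1⟩
  · have h := orthogonal_fourDvd_twentyFour_of_not_eight_dvd h4 h8 h20 h60 h8d hΦ hA hΦ' hA'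
    exact ⟨h.1, h.2.1⟩

end TwentyFourColumn

/-! ## §2 The levels `24 ∣ m`, `5 ∤ m` -/

section TwentyFourDvd

variable {K₂₄ : Type} [Field K₂₄] [NumberField K₂₄] [IsCyclotomicExtension {24} ℚ K₂₄] {Φ₂₄ : CMType K₂₄}
  {A₂₄ : AbelianVariety ℂ} {ι₂₄ : 𝓞 K₂₄ →+* End A₂₄} {θ₂₄ : K₂₄ →+* Module.End ℂ (complexBetti A₂₄.X 1)}
  {K₄ : Type} [Field K₄] [NumberField K₄] [IsCyclotomicExtension {4} ℚ K₄] {Φ₄ : CMType K₄}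
  {A₄ : AbelianVariety ℂ} {ι₄ : 𝓞 K₄ →+* End A₄} {θ₄ : K₄ →+* Module.End ℂ (complexBetti A₄.X 1)}
  {K₁₂ : Type} [Field K₁₂] [NumberField K₁₂] [IsCyclotomicExtension {12} ℚ K₁₂] {Φ₁₂ : CMType K₁₂}
  {A₁₂ : AbelianVariety ℂ} {ι₁₂ : 𝓞 K₁₂ →+* End A₁₂} {θ₁₂ : K₁₂ →+* Module.End ℂ (complexBetti A₁₂.X 1)}
  {k₁ : ℕ} {lev₁ : Fin (k₁ + 1) → ℕ} [∀ i, NeZero (lev₁ i)] [∀ i, NeZero (2 * lev₁ i)]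
  {K : Fin (k₁ + 1) → Type} [∀ i, Field (K i)] [∀ i, NumberField (K i)] [∀ i, IsCyclotomicExtension {lev₁ i} ℚ (K i)]
  {L : Fin (k₁ + 1) → Type} [∀ i, Field (L i)] [∀ i, NumberField (L i)] [∀ i, IsCyclotomicExtension {2 * lev₁ i} ℚ (L i)]
  {Φ : ∀ i, CMType (K i)} {ΦL : ∀ i, CMType (L i)}
  {A A' : Fin (k₁ + 1) → AbelianVariety ℂ} {ι : ∀ i, 𝓞 (K i) →+* End (A i)}
  {θ : ∀ i, K i →+* Module.End ℂ (complexBetti (A i).X 1)} {ι' : ∀ i, 𝓞 (L i) →+* End (A' i)}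
  {θ' : ∀ i, L i →+* Module.End ℂ (complexBetti (A' i).X 1)} {M : ℕ}
  {k₂ : ℕ} {lev₂ : Fin k₂ → ℕ} [∀ j, NeZero (lev₂ j)] {F : Fin k₂ → Type} [∀ j, Field (F j)] [∀ j, NumberField (F j)]
  [∀ j, IsCyclotomicExtension {lev₂ j} ℚ (F j)] {Ψ : ∀ j, CMType (F j)} {C : Fin k₂ → AbelianVariety ℂ}
  {ιC : ∀ j, 𝓞 (F j) →+* End (C j)} {θC : ∀ j, F j →+* Module.End ℂ (complexBetti (C j).X 1)}

omit [∀ i, NeZero (lev₁ i)] [∀ i, NeZero (2 * lev₁ i)] in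
/-- Divisors `d_i > 1` of an odd `M` are odd and at least `3`. [folklore] -/
private theorem odd_and_three_le₃ (hodd : Odd M) (hdvd : ∀ i, lev₁ i ∣ M) (h1 : ∀ i, 1 < lev₁ i) (i : Fin (k₁ + 1)) :
    Odd (lev₁ i) ∧ 3 ≤ lev₁ i := by
  have ho : Odd (lev₁ i) := hodd.of_dvd_nat (hdvd i)
  refine ⟨ho, ?_⟩
  obtain ⟨r, hr⟩ := ho
  have := h1 i
  omega

/-- **The four parts `Y_{24}`-block, `X_4 ⊕ X_{12}`, `⨁_i (X_{d_i} ⊕ X_{2d_i})`, `⨁_j X_{e_j}` of `J_m` (`24 ∣ m`, `5 ∤ m`) are pairwise orthogonal**: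
the `Y_{24}` column (§1, F16 for `X_4`, `X_{12}`) on top of F25 `hom_eq_zero_blocks_twelveTimesOdd`.
[cite: GalleseGoodsonLombardo2024, §3 Thm. 3.0 (last statement)] [cite: MilneCM2006, Ch. I §3 Prop. 3.13] -/
theorem hom_eq_zero_blocks_twentyFourDvd (hodd : Odd M) (hdvd : ∀ i, lev₁ i ∣ M) (h1 : ∀ i, 1 < lev₁ i)
    (hΦ : ∀ i (σ : K i →+* ℂ), σ ∈ (Φ i).1 ↔ 2 * (expOf (lev₁ i) (K i) σ).val < lev₁ i)
    (hΦL : ∀ i (σ : L i →+* ℂ), σ ∈ (ΦL i).1 ↔ 2 * (expOf (2 * lev₁ i) (L i) σ).val < 2 * lev₁ i)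
    (hA : ∀ i, IsCMTypeRealisation (Φ i) (A i) (ι i) (θ i)) (hA' : ∀ i, IsCMTypeRealisation (ΦL i) (A' i) (ι' i) (θ' i))
    (hA₄ : IsCMTypeRealisation Φ₄ A₄ ι₄ θ₄)
    (hΦ₁₂ : ∀ σ : K₁₂ →+* ℂ, σ ∈ Φ₁₂.1 ↔ 2 * (expOf 12 K₁₂ σ).val < 12) (hA₁₂ : IsCMTypeRealisation Φ₁₂ A₁₂ ι₁₂ θ₁₂)
    (hΦ₂₄ : ∀ σ : K₂₄ →+* ℂ, σ ∈ Φ₂₄.1 ↔ 2 * (expOf 24 K₂₄ σ).val < 24) (hA₂₄ : IsCMTypeRealisation Φ₂₄ A₂₄ ι₂₄ θ₂₄)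
    (h4 : ∀ j, 4 ∣ lev₂ j) (h8 : ∀ j, 8 ≤ lev₂ j) (h12 : ∀ j, lev₂ j ≠ 12) (h20 : ∀ j, lev₂ j ≠ 20) (h24 : ∀ j, lev₂ j ≠ 24)
    (h60 : ∀ j, lev₂ j ≠ 60) (hΨ : ∀ j (σ : F j →+* ℂ), σ ∈ (Ψ j).1 ↔ 2 * (expOf (lev₂ j) (F j) σ).val < lev₂ j)
    (hC : ∀ j, IsCMTypeRealisation (Ψ j) (C j) (ιC j) (θC j)) :
    ∀ a b : Fin 4, a ≠ b →
      ∀ f : (![A₂₄, ⨁ fun l : Fin 2 => (![A₄, A₁₂] : Fin 2 → AbelianVariety ℂ) l,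
              ⨁ fun i => ⨁ fun l : Fin 2 => (![A i, A' i] : Fin 2 → AbelianVariety ℂ) l, ⨁ C] : Fin 4 → AbelianVariety ℂ) a ⟶
        (![A₂₄, ⨁ fun l : Fin 2 => (![A₄, A₁₂] : Fin 2 → AbelianVariety ℂ) l,
           ⨁ fun i => ⨁ fun l : Fin 2 => (![A i, A' i] : Fin 2 → AbelianVariety ℂ) l, ⨁ C] : Fin 4 → AbelianVariety ℂ) b, f = 0 := by
  classical
  haveI : NeZero (12 : ℕ) := ⟨by norm_num⟩
  have ho : ∀ i, Odd (lev₁ i) ∧ 3 ≤ lev₁ i := odd_and_three_le₃ hodd hdvd h1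
  -- the `Y_{24}` column
  have o4 := orthogonal_four_twentyFour hA₄ hΦ₂₄ hA₂₄
  have o12 := orthogonal_fourDvd_twentyFour_of_not_eight_dvd (d := 12) (by norm_num) (by norm_num) (by norm_num) (by norm_num) (by norm_num)
    hΦ₁₂ hA₁₂ hΦ₂₄ hA₂₄
  have oA : ∀ i, (∀ u : A i ⟶ A₂₄, u = 0) ∧ (∀ v : A₂₄ ⟶ A i, v = 0) := fun i =>
    let h := orthogonal_odd_twentyFour' (ho i).1 (ho i).2 (hΦ i) (hA i) hΦ₂₄ hA₂₄
    ⟨h.1, h.2.1⟩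
  have oA' : ∀ i, (∀ u : A' i ⟶ A₂₄, u = 0) ∧ (∀ v : A₂₄ ⟶ A' i, v = 0) := fun i =>
    let h := orthogonal_twiceOdd_twentyFour (ho i).1 (ho i).2 (hΦL i) (hA' i) hΦ₂₄ hA₂₄
    ⟨h.1, h.2.1⟩
  have oC : ∀ j, (∀ u : C j ⟶ A₂₄, u = 0) ∧ (∀ v : A₂₄ ⟶ C j, v = 0) := fun j =>
    orthogonal_fourDvd_twentyFour (h4 j) (h8 j) (h20 j) (h24 j) (h60 j) (hΨ j) (hC j) hΦ₂₄ hA₂₄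
  -- block-level relations of `A₂₄`
  have b0 : (∀ u : A₂₄ ⟶ ⨁ fun l : Fin 2 => (![A₄, A₁₂] : Fin 2 → AbelianVariety ℂ) l, u = 0) ∧
      (∀ v : (⨁ fun l : Fin 2 => (![A₄, A₁₂] : Fin 2 → AbelianVariety ℂ) l) ⟶ A₂₄, v = 0) :=
    ⟨fun u => hom_to_pair_eq_zero o4.2.1 o12.2.1 u, fun v => hom_from_pair_eq_zero o4.1 o12.1 v⟩
  have b1 : (∀ u : A₂₄ ⟶ ⨁ fun i => ⨁ fun l : Fin 2 => (![A i, A' i] : Fin 2 → AbelianVariety ℂ) l, u = 0) ∧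
      (∀ v : (⨁ fun i => ⨁ fun l : Fin 2 => (![A i, A' i] : Fin 2 → AbelianVariety ℂ) l) ⟶ A₂₄, v = 0) :=
    ⟨fun u => hom_to_biproduct_eq_zero (fun i w => hom_to_pair_eq_zero (oA i).2 (oA' i).2 w) u,
      fun v => hom_from_biproduct_eq_zero (fun i w => hom_from_pair_eq_zero (oA i).1 (oA' i).1 w) v⟩
  have b2 : (∀ u : A₂₄ ⟶ ⨁ C, u = 0) ∧ (∀ v : (⨁ C) ⟶ A₂₄, v = 0) :=
    ⟨fun u => hom_to_biproduct_eq_zero (fun j w => (oC j).2 w) u, fun v => hom_from_biproduct_eq_zero (fun j w => (oC j).1 w) v⟩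
  exact hom_eq_zero_vecCons (X := A₂₄)
    (F := (![⨁ fun l : Fin 2 => (![A₄, A₁₂] : Fin 2 → AbelianVariety ℂ) l,
      ⨁ fun i => ⨁ fun l : Fin 2 => (![A i, A' i] : Fin 2 → AbelianVariety ℂ) l, ⨁ C] : Fin 3 → AbelianVariety ℂ))
    (Fin.cons b0 (Fin.cons b1 (Fin.cons b2 finZeroElim)))
    (hom_eq_zero_blocks_twelveTimesOdd hodd hdvd h1 hΦ hΦL hA hA' hA₄ hΦ₁₂ hA₁₂ h4 h8 h12 h20 h24 h60 hΨ hC)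

/-- The product of four algebras indexed by `Fin 4`. [folklore] -/
private theorem nonempty_pi_fin_four_algEquiv_prod' (T : Fin 4 → Type) [∀ i, Ring (T i)] [∀ i, Algebra ℚ (T i)] :
    Nonempty ((∀ i, T i) ≃ₐ[ℚ] T 0 × (T 1 × (T 2 × T 3))) := by
  refine ⟨AlgEquiv.ofBijective
    ((Pi.evalAlgHom ℚ T 0).prod ((Pi.evalAlgHom ℚ T 1).prod ((Pi.evalAlgHom ℚ T 2).prod (Pi.evalAlgHom ℚ T 3))))
    ⟨fun f g h => ?_, fun x => ?_⟩⟩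
  · simp only [AlgHom.prod_apply, Pi.evalAlgHom_apply, Prod.mk.injEq] at h
    funext i
    match i with
    | ⟨0, _⟩ => exact h.1
    | ⟨1, _⟩ => exact h.2.1
    | ⟨2, _⟩ => exact h.2.2.1
    | ⟨3, _⟩ => exact h.2.2.2
  · exact ⟨Fin.cons x.1 (Fin.cons x.2.1 (Fin.cons x.2.2.1 (Fin.cons x.2.2.2 finZeroElim))), rfl⟩

/-- **GGL THM. 3.0 + LEMMA 14 at the levels `24 ∣ m`, `5 ∤ m` (family form):
`End⁰(J_m) ≃ₐ[ℚ] Mat₄(ℚ(r₂₄)) × (Mat₃(ℚ(ζ_4)) × ((∏_i Mat₂(ℚ(ζ_{d_i}))) × ∏_j Mat₂(ℚ(ζ_{e_j} − ζ_{e_j}⁻¹))))`**, `r₂₄ = ζ + ζ⁵ + ζ⁷ + ζ¹¹`, `r₂₄² = −6`,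
on the carrier `![A₂₄, A₄ ⊕ A₁₂, ⨁_i (A_i ⊕ A′_i), ⨁_j C_j]` (Lemma 14 (3) for the `Y_{24}`-block, F25 for the rest).
[cite: GalleseGoodsonLombardo2024, §3.5 Lemma 14 and the sentence following it; §3 Thm. 3.0 (4), (5), last statement; §3.4]
[cite: MumfordAV1970, §19 Cor. 2 of Thm. 3 and p. 174] [cite: Shimura1998, §5.1 Prop. 3, 4 (proofs) and Prop. 6] -/
theorem nonempty_endAlgebra_algEquiv_twentyFourDvd [NeZero M] (hodd : Odd M) (hdvd : ∀ i, lev₁ i ∣ M) (hinj₁ : Function.Injective lev₁)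
    (h1 : ∀ i, 1 < lev₁ i) (hΦ : ∀ i (σ : K i →+* ℂ), σ ∈ (Φ i).1 ↔ 2 * (expOf (lev₁ i) (K i) σ).val < lev₁ i)
    (hΦL : ∀ i (σ : L i →+* ℂ), σ ∈ (ΦL i).1 ↔ 2 * (expOf (2 * lev₁ i) (L i) σ).val < 2 * lev₁ i)
    (hA : ∀ i, IsCMTypeRealisation (Φ i) (A i) (ι i) (θ i)) (hA' : ∀ i, IsCMTypeRealisation (ΦL i) (A' i) (ι' i) (θ' i))
    (hΦ₄ : ∀ σ : K₄ →+* ℂ, σ ∈ Φ₄.1 ↔ 2 * (expOf 4 K₄ σ).val < 4) (hA₄ : IsCMTypeRealisation Φ₄ A₄ ι₄ θ₄)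
    (hΦ₁₂ : ∀ σ : K₁₂ →+* ℂ, σ ∈ Φ₁₂.1 ↔ 2 * (expOf 12 K₁₂ σ).val < 12) (hA₁₂ : IsCMTypeRealisation Φ₁₂ A₁₂ ι₁₂ θ₁₂)
    (hΦ₂₄ : ∀ σ : K₂₄ →+* ℂ, σ ∈ Φ₂₄.1 ↔ 2 * (expOf 24 K₂₄ σ).val < 24) (hA₂₄ : IsCMTypeRealisation Φ₂₄ A₂₄ ι₂₄ θ₂₄)
    (h4 : ∀ j, 4 ∣ lev₂ j) (h8 : ∀ j, 8 ≤ lev₂ j) (h12 : ∀ j, lev₂ j ≠ 12) (h20 : ∀ j, lev₂ j ≠ 20) (h24 : ∀ j, lev₂ j ≠ 24)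
    (h60 : ∀ j, lev₂ j ≠ 60) (hinj₂ : Function.Injective lev₂)
    (hΨ : ∀ j (σ : F j →+* ℂ), σ ∈ (Ψ j).1 ↔ 2 * (expOf (lev₂ j) (F j) σ).val < lev₂ j)
    (hC : ∀ j, IsCMTypeRealisation (Ψ j) (C j) (ιC j) (θC j)) :
    Nonempty ((⨁ fun a : Fin 4 =>
        (![A₂₄, ⨁ fun l : Fin 2 => (![A₄, A₁₂] : Fin 2 → AbelianVariety ℂ) l,
           ⨁ fun i => ⨁ fun l : Fin 2 => (![A i, A' i] : Fin 2 → AbelianVariety ℂ) l, ⨁ C] : Fin 4 → AbelianVariety ℂ) a).endAlgebra ≃ₐ[ℚ]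
      Matrix (Fin 4) (Fin 4) (IntermediateField.adjoin ℚ {zetaOf 24 K₂₄ + zetaOf 24 K₂₄ ^ 5 + zetaOf 24 K₂₄ ^ 7 + zetaOf 24 K₂₄ ^ 11}) ×
        (Matrix (Fin 3) (Fin 3) K₄ × ((∀ i, Matrix (Fin 2) (Fin 2) (K i)) ×
          (∀ j, Matrix (Fin 2) (Fin 2) (IntermediateField.adjoin ℚ {zetaOf (lev₂ j) (F j) - (zetaOf (lev₂ j) (F j))⁻¹}))))) := by
  classical
  obtain ⟨E, -⟩ := AbelianVariety.nonempty_algEquiv_endAlgebra_biproduct_pi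
    (A := fun a : Fin 4 => (![A₂₄, ⨁ fun l : Fin 2 => (![A₄, A₁₂] : Fin 2 → AbelianVariety ℂ) l,
      ⨁ fun i => ⨁ fun l : Fin 2 => (![A i, A' i] : Fin 2 → AbelianVariety ℂ) l, ⨁ C] : Fin 4 → AbelianVariety ℂ) a)
    (hom_eq_zero_blocks_twentyFourDvd hodd hdvd h1 hΦ hΦL hA hA' hA₄ hΦ₁₂ hA₁₂ hΦ₂₄ hA₂₄ h4 h8 h12 h20 h24 h60 hΨ hC)
  obtain ⟨P⟩ := nonempty_pi_fin_four_algEquiv_prod'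
    (fun a : Fin 4 => ((![A₂₄, ⨁ fun l : Fin 2 => (![A₄, A₁₂] : Fin 2 → AbelianVariety ℂ) l,
      ⨁ fun i => ⨁ fun l : Fin 2 => (![A i, A' i] : Fin 2 → AbelianVariety ℂ) l, ⨁ C] : Fin 4 → AbelianVariety ℂ) a).endAlgebra)
  obtain ⟨-, -, -, ⟨e₃⟩, -⟩ := nonempty_matrix_four_algEquiv_endAlgebra_twentyFour Φ₂₄ hΦ₂₄ hA₂₄
  obtain ⟨e₀⟩ := nonempty_endAlgebra_four_twelve_algEquiv_matrix hΦ₄ hA₄ hΦ₁₂ hA₁₂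
  obtain ⟨e₁⟩ := nonempty_endAlgebra_algEquiv_pi_matrix_twiceOdd hodd hdvd hinj₁ h1 hΦ hΦL hA hA'
  obtain ⟨e₂⟩ := nonempty_endAlgebra_biproduct_algEquiv_pi_fourDvd h4 h8 h20 h24 h60 hinj₂ hΨ hC
  exact ⟨(E.trans P).trans (AlgEquiv.prodCongr e₃.symm (AlgEquiv.prodCongr e₀ (AlgEquiv.prodCongr e₁ e₂)))⟩

/-- **Dimension count at the levels `24 ∣ m`, `5 ∤ m`: `dim_ℚ End⁰(J) = 50 + 4 Σ_i φ(d_i) + 2 Σ_j φ(e_j)` and `2 dim J = 14 + 2 Σ_i φ(d_i) + Σ_j φ(e_j)`**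
(`m = 24`: `66`, `g = 11` (F18); `m = 48`: `114`, `g = 23`; `m = 72`: `162`, `g = 35`).
[cite: GalleseGoodsonLombardo2024, §3 Thm. 3.0 («dim X_d = φ(d)/2») and §3.5 Lemma 14] [cite: MumfordAV1970, §19 Cor. 2 of Thm. 3] -/
theorem finrank_endAlgebra_twentyFourDvd [NeZero M] (hodd : Odd M) (hdvd : ∀ i, lev₁ i ∣ M) (hinj₁ : Function.Injective lev₁)
    (h1 : ∀ i, 1 < lev₁ i) (hΦ : ∀ i (σ : K i →+* ℂ), σ ∈ (Φ i).1 ↔ 2 * (expOf (lev₁ i) (K i) σ).val < lev₁ i)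
    (hΦL : ∀ i (σ : L i →+* ℂ), σ ∈ (ΦL i).1 ↔ 2 * (expOf (2 * lev₁ i) (L i) σ).val < 2 * lev₁ i)
    (hA : ∀ i, IsCMTypeRealisation (Φ i) (A i) (ι i) (θ i)) (hA' : ∀ i, IsCMTypeRealisation (ΦL i) (A' i) (ι' i) (θ' i))
    (hΦ₄ : ∀ σ : K₄ →+* ℂ, σ ∈ Φ₄.1 ↔ 2 * (expOf 4 K₄ σ).val < 4) (hA₄ : IsCMTypeRealisation Φ₄ A₄ ι₄ θ₄)
    (hΦ₁₂ : ∀ σ : K₁₂ →+* ℂ, σ ∈ Φ₁₂.1 ↔ 2 * (expOf 12 K₁₂ σ).val < 12) (hA₁₂ : IsCMTypeRealisation Φ₁₂ A₁₂ ι₁₂ θ₁₂)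
    (hΦ₂₄ : ∀ σ : K₂₄ →+* ℂ, σ ∈ Φ₂₄.1 ↔ 2 * (expOf 24 K₂₄ σ).val < 24) (hA₂₄ : IsCMTypeRealisation Φ₂₄ A₂₄ ι₂₄ θ₂₄)
    (h4 : ∀ j, 4 ∣ lev₂ j) (h8 : ∀ j, 8 ≤ lev₂ j) (h12 : ∀ j, lev₂ j ≠ 12) (h20 : ∀ j, lev₂ j ≠ 20) (h24 : ∀ j, lev₂ j ≠ 24)
    (h60 : ∀ j, lev₂ j ≠ 60) (hinj₂ : Function.Injective lev₂)
    (hΨ : ∀ j (σ : F j →+* ℂ), σ ∈ (Ψ j).1 ↔ 2 * (expOf (lev₂ j) (F j) σ).val < lev₂ j)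
    (hC : ∀ j, IsCMTypeRealisation (Ψ j) (C j) (ιC j) (θC j)) :
    finrank ℚ (⨁ fun a : Fin 4 =>
        (![A₂₄, ⨁ fun l : Fin 2 => (![A₄, A₁₂] : Fin 2 → AbelianVariety ℂ) l,
           ⨁ fun i => ⨁ fun l : Fin 2 => (![A i, A' i] : Fin 2 → AbelianVariety ℂ) l, ⨁ C] : Fin 4 → AbelianVariety ℂ) a).endAlgebra =
      50 + 4 * ∑ i, Nat.totient (lev₁ i) + 2 * ∑ j, Nat.totient (lev₂ j) ∧
    2 * (⨁ fun a : Fin 4 =>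
        (![A₂₄, ⨁ fun l : Fin 2 => (![A₄, A₁₂] : Fin 2 → AbelianVariety ℂ) l,
           ⨁ fun i => ⨁ fun l : Fin 2 => (![A i, A' i] : Fin 2 → AbelianVariety ℂ) l, ⨁ C] : Fin 4 → AbelianVariety ℂ) a).dim =
      14 + 2 * ∑ i, Nat.totient (lev₁ i) + ∑ j, Nat.totient (lev₂ j) := by
  classical
  obtain ⟨hfr₃, hdim₃⟩ := finrank_endAlgebra_twelveTimesOdd hodd hdvd hinj₁ h1 hΦ hΦL hA hA' hΦ₄ hA₄ hΦ₁₂ hA₁₂ h4 h8 h12 h20 h24 h60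
    hinj₂ hΨ hC
  obtain ⟨hd₂₄, -, hF₂₄, -, -, hfr₂₄, -⟩ := nonempty_matrix_four_algEquiv_endAlgebra_twentyFour Φ₂₄ hΦ₂₄ hA₂₄
  refine ⟨?_, ?_⟩
  · -- through the block decomposition `End⁰ ≅ End⁰(A₂₄) × End⁰(F25 carrier)` read off from the two explicit descriptions
    obtain ⟨e⟩ := nonempty_endAlgebra_algEquiv_twentyFourDvd hodd hdvd hinj₁ h1 hΦ hΦL hA hA' hΦ₄ hA₄ hΦ₁₂ hA₁₂ hΦ₂₄ hA₂₄ h4 h8 h12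
      h20 h24 h60 hinj₂ hΨ hC
    obtain ⟨e'⟩ := nonempty_endAlgebra_algEquiv_twelveTimesOdd hodd hdvd hinj₁ h1 hΦ hΦL hA hA' hΦ₄ hA₄ hΦ₁₂ hA₁₂ h4 h8 h12 h20 h24 h60
      hinj₂ hΨ hC
    obtain ⟨-, -, -, ⟨e₃⟩, -⟩ := nonempty_matrix_four_algEquiv_endAlgebra_twentyFour Φ₂₄ hΦ₂₄ hA₂₄
    haveI : ∀ j, FiniteDimensional ℚ (IntermediateField.adjoin ℚ {zetaOf (lev₂ j) (F j) - (zetaOf (lev₂ j) (F j))⁻¹}) := fun j =>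
      IntermediateField.finiteDimensional_left _
    haveI : ∀ j, Module.Finite ℚ (Matrix (Fin 2) (Fin 2)
        (IntermediateField.adjoin ℚ {zetaOf (lev₂ j) (F j) - (zetaOf (lev₂ j) (F j))⁻¹})) := fun j => Module.Finite.matrix
    haveI : ∀ j, Module.Free ℚ (Matrix (Fin 2) (Fin 2)
        (IntermediateField.adjoin ℚ {zetaOf (lev₂ j) (F j) - (zetaOf (lev₂ j) (F j))⁻¹})) := fun j => inferInstance
    haveI : ∀ i, Module.Finite ℚ (Matrix (Fin 2) (Fin 2) (K i)) := fun i => Module.Finite.matrix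
    haveI : ∀ i, Module.Free ℚ (Matrix (Fin 2) (Fin 2) (K i)) := fun i => inferInstance
    haveI : Module.Finite ℚ (∀ j, Matrix (Fin 2) (Fin 2)
        (IntermediateField.adjoin ℚ {zetaOf (lev₂ j) (F j) - (zetaOf (lev₂ j) (F j))⁻¹})) := inferInstance
    haveI : Module.Free ℚ (∀ j, Matrix (Fin 2) (Fin 2)
        (IntermediateField.adjoin ℚ {zetaOf (lev₂ j) (F j) - (zetaOf (lev₂ j) (F j))⁻¹})) := inferInstance
    haveI : Module.Finite ℚ (∀ i, Matrix (Fin 2) (Fin 2) (K i)) := inferInstance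
    haveI : Module.Free ℚ (∀ i, Matrix (Fin 2) (Fin 2) (K i)) := inferInstance
    haveI : Module.Finite ℚ ((∀ i, Matrix (Fin 2) (Fin 2) (K i)) × (∀ j, Matrix (Fin 2) (Fin 2)
        (IntermediateField.adjoin ℚ {zetaOf (lev₂ j) (F j) - (zetaOf (lev₂ j) (F j))⁻¹}))) := inferInstance
    haveI : Module.Free ℚ ((∀ i, Matrix (Fin 2) (Fin 2) (K i)) × (∀ j, Matrix (Fin 2) (Fin 2)
        (IntermediateField.adjoin ℚ {zetaOf (lev₂ j) (F j) - (zetaOf (lev₂ j) (F j))⁻¹}))) := inferInstance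
    haveI : Module.Finite ℚ (Matrix (Fin 3) (Fin 3) K₄) := Module.Finite.matrix
    haveI : Module.Free ℚ (Matrix (Fin 3) (Fin 3) K₄) := inferInstance
    haveI : Module.Finite ℚ (Matrix (Fin 3) (Fin 3) K₄ × ((∀ i, Matrix (Fin 2) (Fin 2) (K i)) × (∀ j, Matrix (Fin 2) (Fin 2)
        (IntermediateField.adjoin ℚ {zetaOf (lev₂ j) (F j) - (zetaOf (lev₂ j) (F j))⁻¹})))) := inferInstance
    haveI : Module.Free ℚ (Matrix (Fin 3) (Fin 3) K₄ × ((∀ i, Matrix (Fin 2) (Fin 2) (K i)) × (∀ j, Matrix (Fin 2) (Fin 2)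
        (IntermediateField.adjoin ℚ {zetaOf (lev₂ j) (F j) - (zetaOf (lev₂ j) (F j))⁻¹})))) := inferInstance
    haveI : FiniteDimensional ℚ (IntermediateField.adjoin ℚ {zetaOf 24 K₂₄ + zetaOf 24 K₂₄ ^ 5 + zetaOf 24 K₂₄ ^ 7 + zetaOf 24 K₂₄ ^ 11}) :=
      IntermediateField.finiteDimensional_left _
    haveI : Module.Finite ℚ (Matrix (Fin 4) (Fin 4)
        (IntermediateField.adjoin ℚ {zetaOf 24 K₂₄ + zetaOf 24 K₂₄ ^ 5 + zetaOf 24 K₂₄ ^ 7 + zetaOf 24 K₂₄ ^ 11})) := Module.Finite.matrix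
    haveI : Module.Free ℚ (Matrix (Fin 4) (Fin 4)
        (IntermediateField.adjoin ℚ {zetaOf 24 K₂₄ + zetaOf 24 K₂₄ ^ 5 + zetaOf 24 K₂₄ ^ 7 + zetaOf 24 K₂₄ ^ 11})) := inferInstance
    have hrest : finrank ℚ (Matrix (Fin 3) (Fin 3) K₄ × ((∀ i, Matrix (Fin 2) (Fin 2) (K i)) × (∀ j, Matrix (Fin 2) (Fin 2)
        (IntermediateField.adjoin ℚ {zetaOf (lev₂ j) (F j) - (zetaOf (lev₂ j) (F j))⁻¹})))) =
        18 + 4 * ∑ i, Nat.totient (lev₁ i) + 2 * ∑ j, Nat.totient (lev₂ j) := by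
      rw [← e'.toLinearEquiv.finrank_eq, hfr₃]
    have hfirst : finrank ℚ (Matrix (Fin 4) (Fin 4)
        (IntermediateField.adjoin ℚ {zetaOf 24 K₂₄ + zetaOf 24 K₂₄ ^ 5 + zetaOf 24 K₂₄ ^ 7 + zetaOf 24 K₂₄ ^ 11})) = 32 := by
      rw [e₃.toLinearEquiv.finrank_eq, hfr₂₄]
    rw [e.toLinearEquiv.finrank_eq, Module.finrank_prod, hfirst, hrest]
    omega
  · have h3 : 2 * (⨁ fun a : Fin 3 => (![⨁ fun l : Fin 2 => (![A₄, A₁₂] : Fin 2 → AbelianVariety ℂ) l,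
        ⨁ fun i => ⨁ fun l : Fin 2 => (![A i, A' i] : Fin 2 → AbelianVariety ℂ) l, ⨁ C] : Fin 3 → AbelianVariety ℂ) a).dim =
        2 * ((⨁ fun l : Fin 2 => (![A₄, A₁₂] : Fin 2 → AbelianVariety ℂ) l).dim +
          (⨁ fun i => ⨁ fun l : Fin 2 => (![A i, A' i] : Fin 2 → AbelianVariety ℂ) l).dim + (⨁ C).dim) := by
      rw [AbelianVariety.dim_biproduct, Fin.sum_univ_three]
      rfl
    rw [AbelianVariety.dim_biproduct, Fin.sum_univ_four]
    show 2 * (A₂₄.dim + (⨁ fun l : Fin 2 => (![A₄, A₁₂] : Fin 2 → AbelianVariety ℂ) l).dim +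
        (⨁ fun i => ⨁ fun l : Fin 2 => (![A i, A' i] : Fin 2 → AbelianVariety ℂ) l).dim + (⨁ C).dim) =
      14 + 2 * ∑ i, Nat.totient (lev₁ i) + ∑ j, Nat.totient (lev₂ j)
    rw [hd₂₄]
    omega

end TwentyFourDvd

end HyperellipticJacobian

end Literature.AlgebraicGeometry.ComplexMultiplication

end
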